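import Summits.KontsevichZagierPeriods.KontsevichZagierPeriods.Theorems.FurushoPentagonHoffmanRelationInKZCubicalTransportAux2
import Literature.NumberTheory.Transcendental.KZCubicalCalculus
import Literature.NumberTheory.Transcendental.KZDominatedFamilyRelations

/-!
# `PentagonInKZ`, line `logfree-gauge-corner-flatness`: stub `simplexToCube`

Stub `simplexToCube` of the crux `PentagonInKZ` (stmt-KontsevichZagierPeriods-11348, route
FurushoPentagon). The crux's path integrals are iterated integrals
`∫_{bnd > t₀ > ⋯ > t_{n-1} > 0} ∏ᵢ dtᵢ/(tᵢ − πᵢ)` over a SCALED open ordered simplex; the lead's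
corner-flatness argument runs on the closed unit cube `KZ.cube n`. This file supplies the bridge:
a representation `r` on the scaled simplex with integrand `∏ᵢ 1/(tᵢ − πᵢ)` and a representation
`r'` on `KZ.cube n` whose integrand on the OPEN cube is the pulled-back form
`∏ᵢ (bnd ∏_{j<i} x_j) / (bnd ∏_{j≤i} x_j − πᵢ)` differ by Kontsevich–Zagier relations.

Proof: two moves.
* Domain additivity (rule (1)): `[cube, f] ≡ [open cube, f]`, the difference `cube ∖ open cube`
  lying in the null union of the coordinate hyperplanes `{xᵢ = 0}`, `{xᵢ = 1}`
  (`KZ.IntegralRep.of_sub_of_restrict_mem_relations`).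
* ONE change of variables (rule (2)) along the scaled cubical chart
  `Φ(x)ᵢ = bnd · x₀ x₁ ⋯ xᵢ`, a `ℚ`-polynomial map, injective on the open cube with image the scaled
  simplex, lower-triangular Jacobian of determinant `∏ᵢ bnd ∏_{j<i} x_j > 0`; the unscaled chart
  `C(x)ᵢ = x₀ ⋯ xᵢ` and its calculus are the monomial-chart toolkit of the sibling crux
  `HoffmanRelationInKZ` (`FurushoPentagonHoffmanRelationInKZCubicalTransportAux{,2}.lean`); as
  there, the chart is passed as a hypothesis `hC : ∀ x i, C x i = ∏_{j ≤ i} x_j` (no definition).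

References: M. Kontsevich, D. Zagier, *Periods* (2001), §1.2 rules (1), (2); I. Soudères,
*Motivic double shuffle*, IJNT 6 (2010), §1.3 (cubical coordinates).
-/

noncomputable section

open Set MeasureTheory MvPolynomial
open Literature.NumberTheory.Transcendental
open Literature.ModelTheory.ExponentialFields (IsSemialgebraic)
open Summit.KontsevichZagierPeriods.FurushoPentagon.HoffmanRelationInKZ (hasFDerivAt_monomialChart
  det_monomialChart injOn_cubicalChart image_cubicalChart)

namespace Summit.KontsevichZagierPeriods.FurushoPentagon.PentagonInKZ

namespace SimplexToCube

variable {n : ℕ}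

/-! ### Rows of the chart -/

/-- The rows `{j ≤ i}` of the cubical chart are the rows `{j < i + 1}` of the toolkit. [folklore] -/
theorem filter_le_eq (i : Fin n) :
    Finset.univ.filter (fun j : Fin n => j ≤ i) =
      Finset.univ.filter (fun j : Fin n => (j : ℕ) < (i : ℕ) + 1) := by
  ext j
  simp only [Finset.mem_filter, Finset.mem_univ, true_and, Fin.le_def]
  omega

/-- The off-diagonal part of the row `{j ≤ i}` is `{j < i}`. [folklore] -/
theorem filter_le_erase (i : Fin n) :
    (Finset.univ.filter (fun j : Fin n => j ≤ i)).erase i =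
      Finset.univ.filter (fun j : Fin n => j < i) := by
  ext j
  simp only [Finset.mem_erase, Finset.mem_filter, Finset.mem_univ, true_and]
  constructor
  · rintro ⟨hne, hle⟩; exact lt_of_le_of_ne hle hne
  · intro hlt; exact ⟨hlt.ne, hlt.le⟩

/-! ### The open unit cube inside `KZ.cube n` -/

/-- The boundary `[0,1]ⁿ ∖ (0,1)ⁿ` is Lebesgue-null (it lies in the union of the coordinate
hyperplanes `{xᵢ = 0}`, `{xᵢ = 1}`). [folklore] -/
theorem volume_cube_diff_openUnitCube (n : ℕ) : volume (KZ.cube n \ openUnitCube n) = 0 := by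
  have hsub : KZ.cube n \ openUnitCube n ⊆
      ⋃ i : Fin n, ({x : Fin n → ℝ | x i = 0} ∪ {x | x i = 1}) := by
    rintro x ⟨hx, hx'⟩
    simp only [mem_openUnitCube_iff, mem_Ioo, not_forall] at hx'
    obtain ⟨i, hi⟩ := hx'
    refine mem_iUnion.2 ⟨i, ?_⟩
    have h0 := KZ.mem_cube.1 hx i
    rcases not_and_or.mp hi with h | h
    · exact Or.inl (le_antisymm (not_lt.mp h) h0.1)
    · exact Or.inr (le_antisymm h0.2 (not_lt.mp h))
  refine measure_mono_null hsub (measure_iUnion_null fun i => ?_)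
  rw [measure_union_null_iff, volume_pi]
  exact ⟨Measure.pi_hyperplane _ i 0, Measure.pi_hyperplane _ i 1⟩

/-! ### The scaled cubical chart `Φ = b • C`, `C(x)ᵢ = x₀ ⋯ xᵢ` -/

/-- The scaled chart `b • C` is differentiable, with derivative `b` times the Leibniz-rule
derivative of the monomial chart with rows `{j ≤ i}`. [folklore] -/
theorem hasFDerivAt_smul_chart (C : (Fin n → ℝ) → (Fin n → ℝ))
    (hC : ∀ x i, C x i = ∏ j ∈ Finset.univ.filter (fun j : Fin n => j ≤ i), x j) (b : ℝ)
    (x : Fin n → ℝ) :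
    HasFDerivAt (b • C) (b • ContinuousLinearMap.pi fun i =>
      ∑ j ∈ Finset.univ.filter (fun j : Fin n => j ≤ i),
        (∏ k ∈ (Finset.univ.filter (fun j : Fin n => j ≤ i)).erase j, x k) •
          ContinuousLinearMap.proj (R := ℝ) (φ := fun _ : Fin n => ℝ) j) x := by
  obtain rfl : C = fun x i => ∏ j ∈ Finset.univ.filter (fun j : Fin n => j ≤ i), x j :=
    funext fun x => funext fun i => hC x i
  exact (hasFDerivAt_monomialChart
    (fun i => Finset.univ.filter (fun j : Fin n => j ≤ i)) x).const_smul b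

/-- **The Jacobian determinant** of the scaled chart is `∏ᵢ b ∏_{j<i} x_j` (`det (b • L) = bⁿ det L`
and the lower-triangular `det_monomialChart`). [folklore] -/
theorem det_smul_chartDeriv (b : ℝ) (x : Fin n → ℝ) :
    (b • ContinuousLinearMap.pi fun i =>
      ∑ j ∈ Finset.univ.filter (fun j : Fin n => j ≤ i),
        (∏ k ∈ (Finset.univ.filter (fun j : Fin n => j ≤ i)).erase j, x k) •
          ContinuousLinearMap.proj (R := ℝ) (φ := fun _ : Fin n => ℝ) j).det =
      ∏ i : Fin n, (b * ∏ j ∈ Finset.univ.filter (fun j : Fin n => j < i), x j) := by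
  rw [ContinuousLinearMap.det, ContinuousLinearMap.toLinearMap_smul, LinearMap.det_smul,
    Module.finrank_fin_fun]
  have hdet := det_monomialChart (fun i => Finset.univ.filter (fun j : Fin n => j ≤ i))
    (fun _ _ hj => (Finset.mem_filter.1 hj).2) (fun i => by simp) x
  rw [ContinuousLinearMap.det] at hdet
  rw [hdet, Finset.prod_mul_distrib, Finset.prod_const, Finset.card_univ, Fintype.card_fin]
  simp_rw [filter_le_erase]

/-- On the open cube the Jacobian determinant is positive (`b > 0`). [folklore] -/
theorem jacobian_pos {b : ℝ} (hb : 0 < b) {x : Fin n → ℝ} (hx : x ∈ openUnitCube n) :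
    0 < ∏ i : Fin n, (b * ∏ j ∈ Finset.univ.filter (fun j : Fin n => j < i), x j) :=
  Finset.prod_pos fun _ _ => mul_pos hb (Finset.prod_pos fun j _ => (hx j).1)

/-- The scaled chart is a `ℚ`-polynomial map (for rational `b`), hence `ℚ`-semialgebraic on every
`ℚ`-semialgebraic set. [cite: BochnakCosteRoy1998, §2.2] -/
theorem isSemialgebraicMapOn_smul_chart (C : (Fin n → ℝ) → (Fin n → ℝ))
    (hC : ∀ x i, C x i = ∏ j ∈ Finset.univ.filter (fun j : Fin n => j ≤ i), x j) (b : ℚ)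
    {σ : Set (Fin n → ℝ)} (hσ : IsSemialgebraic ℚ σ) :
    IsSemialgebraicMapOn ℚ σ ((b : ℝ) • C) := by
  refine (isSemialgebraicMapOn_aeval hσ fun i =>
    MvPolynomial.C b * ∏ j ∈ Finset.univ.filter (fun j : Fin n => j ≤ i), X j).congr fun x _ => ?_
  funext i
  rw [Pi.smul_apply, Pi.smul_apply, smul_eq_mul, hC]
  simp [map_prod]

/-- The scaled chart is injective on the open cube (`b ≠ 0`; the cubical chart is,
`injOn_cubicalChart`). [folklore] -/
theorem injOn_smul_chart (C : (Fin n → ℝ) → (Fin n → ℝ))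
    (hC : ∀ x i, C x i = ∏ j ∈ Finset.univ.filter (fun j : Fin n => j ≤ i), x j) {b : ℝ}
    (hb : b ≠ 0) : InjOn (b • C) (openUnitCube n) := by
  have hC' : ∀ x i, C x i =
      ∏ j ∈ Finset.univ.filter (fun j : Fin n => (j : ℕ) < (i : ℕ) + 1), x j := fun x i => by
    rw [hC, filter_le_eq]
  intro x hx y hy hxy
  have hxy' : b • C x = b • C y := hxy
  exact injOn_cubicalChart (fun m (x : Fin n → ℝ) => ∏ j : Fin n, if (j : ℕ) < m then x j else 1)
    (fun _ _ => rfl) C hC' hx hy (smul_right_injective _ hb hxy')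

/-- **Image.** The scaled chart maps the open cube onto the scaled open ordered simplex
`{b > t₀ > ⋯ > t_{n-1} > 0}` (`b > 0`; the cubical chart maps it onto Kontsevich's simplex,
`image_cubicalChart`). [cite: Souderes2010, §1.3] -/
theorem image_smul_chart (C : (Fin n → ℝ) → (Fin n → ℝ))
    (hC : ∀ x i, C x i = ∏ j ∈ Finset.univ.filter (fun j : Fin n => j ≤ i), x j) {b : ℝ}
    (hb : 0 < b) :
    (b • C) '' openUnitCube n = {t | (∀ i, 0 < t i ∧ t i < b) ∧ StrictAnti t} := by
  have hC' : ∀ x i, C x i =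
      ∏ j ∈ Finset.univ.filter (fun j : Fin n => (j : ℕ) < (i : ℕ) + 1), x j := fun x i => by
    rw [hC, filter_le_eq]
  have h1 : (b • C) '' openUnitCube n = (fun t => b • t) '' (C '' openUnitCube n) := by
    rw [Set.image_image]; rfl
  have h2 : C '' openUnitCube n = KZ.openOrderedSimplex n :=
    image_cubicalChart (fun m (x : Fin n → ℝ) => ∏ j : Fin n, if (j : ℕ) < m then x j else 1)
      (fun _ _ => rfl) C hC'
  rw [h1, h2]
  ext t
  constructor
  · rintro ⟨s, ⟨h0, h1, hanti⟩, rfl⟩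
    refine ⟨fun i => ⟨?_, ?_⟩, fun i j hij => ?_⟩
    · simp only [Pi.smul_apply, smul_eq_mul]; exact mul_pos hb (h0 i)
    · simp only [Pi.smul_apply, smul_eq_mul]; exact mul_lt_of_lt_one_right hb (h1 i)
    · simp only [Pi.smul_apply, smul_eq_mul]; exact mul_lt_mul_of_pos_left (hanti hij) hb
  · rintro ⟨hb', hanti⟩
    refine ⟨b⁻¹ • t, ⟨fun i => ?_, fun i => ?_, fun i j hij => ?_⟩, ?_⟩
    · simp only [Pi.smul_apply, smul_eq_mul]; exact mul_pos (inv_pos.2 hb) (hb' i).1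
    · simp only [Pi.smul_apply, smul_eq_mul]; rw [inv_mul_lt_one₀ hb]; exact (hb' i).2
    · simp only [Pi.smul_apply, smul_eq_mul]
      exact mul_lt_mul_of_pos_left (hanti hij) (inv_pos.2 hb)
    · exact smul_inv_smul₀ hb.ne' t

/-- **The pull-back identity** (pure algebra, valid with Lean's `x / 0 = 0`):
`∏ᵢ aᵢ/cᵢ = (∏ᵢ 1/cᵢ) · ∏ᵢ aᵢ`. [folklore] -/
theorem prod_div_eq (a c : Fin n → ℝ) :
    ∏ i, a i / c i = (∏ i, 1 / c i) * ∏ i, a i := by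
  rw [← Finset.prod_mul_distrib]
  exact Finset.prod_congr rfl fun i _ => (one_div_mul_eq_div (c i) (a i)).symm

end SimplexToCube

open SimplexToCube

/-- **Stub `simplexToCube`.** A representation `r` on the scaled open ordered simplex
`{bnd > t₀ > ⋯ > t_{n-1} > 0}` with integrand `∏ᵢ 1/(tᵢ − πᵢ)` and a representation `r'` on the
closed unit cube whose integrand on the open cube is `∏ᵢ (bnd ∏_{j<i} x_j)/(bnd ∏_{j≤i} x_j − πᵢ)`
differ by Kontsevich–Zagier relations: restriction to the open cube off the null boundary
(rule (1)) and ONE change of variables along `tᵢ = bnd · x₀ ⋯ xᵢ` (rule (2)).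
[cite: KontsevichZagier2001, §1.2 rules (1), (2)] -/
theorem simplexToCube : ∀ (n : ℕ) (bnd : ℚ) (π : Fin n → ℚ) (r r' : KZ.IntegralRep n), 0 < bnd → r.domain = {t : Fin n → ℝ | (∀ i, 0 < t i ∧ t i < (bnd : ℝ)) ∧ StrictAnti t} → Set.EqOn r.integrand (fun t => ∏ i, 1 / (t i - (π i : ℝ))) r.domain → r'.domain = KZ.cube n → (∀ x : Fin n → ℝ, (∀ i, 0 < x i ∧ x i < 1) → r'.integrand x = ∏ i : Fin n, ((bnd : ℝ) * ∏ j ∈ Finset.univ.filter (fun j : Fin n => j < i), x j) / ((bnd : ℝ) * (∏ j ∈ Finset.univ.filter (fun j : Fin n => j ≤ i), x j) - (π i : ℝ))) → KZ.of r - KZ.of r' ∈ KZ.relations := by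
  intro n bnd π r r' hbnd hdom hint hdom' hint'
  have hb : (0 : ℝ) < bnd := by exact_mod_cast hbnd
  -- the cubical chart, as a hypothesis
  set C : (Fin n → ℝ) → (Fin n → ℝ) :=
    fun x i => ∏ j ∈ Finset.univ.filter (fun j : Fin n => j ≤ i), x j
  have hC : ∀ x i, C x i = ∏ j ∈ Finset.univ.filter (fun j : Fin n => j ≤ i), x j :=
    fun _ _ => rfl
  -- rule (1): restrict `r'` to the open cube
  have hsub : openUnitCube n ⊆ r'.domain := hdom' ▸ KZ.openUnitCube_subset_cube
  have e1 : KZ.of r' - KZ.of (r'.restrict (openUnitCube n) isSemialgebraic_openUnitCube hsub) ∈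
      KZ.relations :=
    r'.of_sub_of_restrict_mem_relations isSemialgebraic_openUnitCube hsub
      (by rw [hdom']; exact volume_cube_diff_openUnitCube n)
  -- rule (2): one change of variables along the scaled cubical chart `bnd • C`
  have e2 : KZ.of (r'.restrict (openUnitCube n) isSemialgebraic_openUnitCube hsub) - KZ.of r ∈
      KZ.changeOfVariablesRel := by
    refine ⟨n, r'.restrict (openUnitCube n) isSemialgebraic_openUnitCube hsub, r, (bnd : ℝ) • C,
      fun x => (bnd : ℝ) • ContinuousLinearMap.pi fun i =>
        ∑ j ∈ Finset.univ.filter (fun j : Fin n => j ≤ i),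
          (∏ k ∈ (Finset.univ.filter (fun j : Fin n => j ≤ i)).erase j, x k) •
            ContinuousLinearMap.proj (R := ℝ) (φ := fun _ : Fin n => ℝ) j,
      ?_, ?_, ?_, ?_, ?_, rfl⟩
    · exact isSemialgebraicMapOn_smul_chart C hC bnd isSemialgebraic_openUnitCube
    · intro x _; exact (hasFDerivAt_smul_chart C hC _ x).hasFDerivWithinAt
    · exact injOn_smul_chart C hC hb.ne'
    · rw [hdom, KZ.IntegralRep.domain_restrict, image_smul_chart C hC hb]
    · intro x hx
      have hx' : x ∈ openUnitCube n := hx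
      have hΦx : ((bnd : ℝ) • C) x ∈ r.domain := by
        rw [hdom, ← image_smul_chart C hC hb]; exact mem_image_of_mem _ hx'
      rw [KZ.IntegralRep.integrand_restrict, hint' x hx', hint hΦx, det_smul_chartDeriv,
        abs_of_pos (jacobian_pos hb hx')]
      exact prod_div_eq _ _
  have : KZ.of r - KZ.of r' = -((KZ.of r' -
      KZ.of (r'.restrict (openUnitCube n) isSemialgebraic_openUnitCube hsub)) +
      (KZ.of (r'.restrict (openUnitCube n) isSemialgebraic_openUnitCube hsub) - KZ.of r)) := by
    abel
  rw [this]
  exact KZ.relations.neg_mem (KZ.relations.add_mem e1 (KZ.changeOfVariablesRel_subset_relations e2))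

end Summit.KontsevichZagierPeriods.FurushoPentagon.PentagonInKZ
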